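import Summits.HodgeConjecture.HodgeConjecture.Theorems.F0P6aEmbeddingTorsorPlaces   -- ★ p847748 (GEN): torsor `exists_algEquiv_eq_structural_comp`, `ker_residue_restrict_structural_comp_algEquiv`; re-exports ★ p847313 `ker_residue_restrict_comp_complexConj`, `complexConj_inv`
import HarnessLib

/-!
# Crux `HLiu418` — P6 sub-line **F0-P6a**, ROW (d) of the canonical twist ideal: `𝔞_can(m, τR, w)` IS COPRIME TO ITS CONJUGATE (under `m_unmixed`)

Cell `hodgecm-mathlib` (D-0151), crux `stmt-HodgeConjecture-24832` (hLiu418), `--supports` only (count-neutral).  Sequel of ★ p849355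
`F0P6aCanonicalTwistIdealArithRows` (rows (a)(b)(c)(FROB-𝔞)(π1)(FROB-can) of `(𝔞_can, p^f)`); asked by «L7» LA7-p02 (g3) (S6+) 2026-09-02T06:07:15Z for the
Frobenius datum `h₀d` of `exists_twistData_letterRows₄`, because the Serre-twist cover (S1a) ★ p849706 `exists_serreTwist_cover_rows` needs
`𝔞_γ ⊔ 𝔞̄_γ = ⊤` (A-p01 (g28) MEMO-ESHEET §2 (S1)).  THEOREMS ONLY (no definition, no instance, no notation, no named fact, no `sorry`); no `Lines` import.

THE POINT.  Row (d) `𝔞_can ⊔ c • 𝔞_can = ⊤` is NOT among the E-READINGS rows and NOT a consequence of `m_pair`∕`m_banal` alone: a MIXED banal block `u`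
(some `τ ↦ u` with `m τ = 2`, some with `m τ = 0`) would put `𝔭_u` into both `𝔞_can` and `c • 𝔞_can`.  It follows from the KOTTWITZ ROW `m_unmixed` («`m`
constant on every banal block», the `PELKottLawAt` ∕ §0c `kottRows_explicit` ∕ snippet `kottRowsE_unmixed` token — (K-prov-3) `UnmixedAt`), with `m_pair`
and `m_banal`; `m_count` is not needed.  PROOF: `c • ∏_{τ ∈ Φ′} 𝔭_τ = ∏_{τ ∈ Φ′} 𝔭_{τ ∘ c}` (★ `ker_residue_restrict_comp_complexConj`); all factors are
maximal (`F ∕ ℚ` Galois torsor: `𝔭_{τ_w ∘ g} = 𝔭_{g⁻¹ • w}`); and NO factor of the first product equals a factor of the second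
(`ker_ne_ker_comp_complexConj_of_mem_canType`: `𝔭_{τ₁} = 𝔭_{τ₂ ∘ c}` with `τ₁, τ₂ ∈ Φ′(m)` is impossible — on the pair `{w, c•w}` by the exclusions
`τ ∤ c•w`, on a banal block because `m_unmixed` gives `m (τ₂ ∘ c) = m τ₁ ≠ 0`, `m_pair` then `m τ₂ = 1`, against `m_banal`), so the products are coprime
(Mathlib `Ideal.sup_prod_eq_top`, `Ideal.IsMaximal.coprime_of_ne`).

MAIN STATEMENTS.  §1 `ker_residue_restrict_isMaximal`, `ker_ne_ker_comp_complexConj_of_mem_canType`, HEAD-m **`canonicalTwistIdeal_sup_complexConj_smul_eq_top`**;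
§2 HEAD-σ **`canonicalTwistIdeal_sup_complexConj_smul_eq_top_sigma`** (`m := M ∘ (σ₁ ∘ ·)`, the ★ p849355 HEAD-σ ∕ (S6) `h₀d` spelling).

HC_CM is proved only modulo the 7 printed citations (2 remaining named inputs hLiu418 24832, h413 24833) until rung 0 closes; nothing here changes a count.
[cite: Shimura1998, §13.1 Theorem 1 (pp. 97–99) and (7)] [cite: RapoportSmithlingZhang2020Diagonal, §4.1 (4.6)–(4.8) p. 16; §3.2 (3.8) p. 11]
[cite: CasselsFrohlichANT1967, Ch. VII §1.1]
-/

set_option autoImplicit false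
set_option linter.dupNamespace false  -- `Summit.HodgeConjecture.HodgeConjecture.…` BY DESIGN (D-0017)

noncomputable section

open NumberField IsDedekindDomain IsLocalRing
open scoped Pointwise
open Literature.NumberTheory.GaloisRepresentations (closureValuationSubring)
open Literature.NumberTheory.Automorphic
open Summit.HodgeConjecture.HodgeConjecture.Theorems.F0P6aKottwitzCountAtSplitPlace (ker_residue_restrict_comp_complexConj complexConj_inv)
open Summit.HodgeConjecture.HodgeConjecture.Theorems.F0P6aEmbeddingTorsorPlaces (exists_algEquiv_eq_structural_comp
  ker_residue_restrict_structural_comp_algEquiv)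

namespace Summit.HodgeConjecture.HodgeConjecture.Theorems.F0P6aCanonicalTwistIdealConjCoprime

variable {F : Type} [Field F] [NumberField F] [IsCMField F] (w : HeightOneSpectrum (𝓞 F))

/-! ### §1 ROW (d): `𝔞_can(m, τR, w) ⊔ c • 𝔞_can(m, τR, w) = ⊤` -/

section RowD


variable (τR : (F →+* AlgebraicClosure (w.adicCompletion F)) → (𝓞 F →+* ↥(closureValuationSubring (w.adicCompletion F))))
  (hτR : ∀ (τ : F →+* AlgebraicClosure (w.adicCompletion F)) (x : 𝓞 F),
    ((τR τ x : ↥(closureValuationSubring (w.adicCompletion F))) : AlgebraicClosure (w.adicCompletion F)) = τ (x : F))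

omit [IsCMField F] in
include hτR in
/-- Every embedding prime `ker (residue ∘ τR τ)` is MAXIMAL (`F ∕ ℚ` Galois: `τ = τ_w ∘ g` induces the place `g⁻¹ • w`, ★ torsor p847748).
[cite: CasselsFrohlichANT1967, Ch. VII §1.1] -/
theorem ker_residue_restrict_isMaximal [IsGalois ℚ F] (τ : F →+* AlgebraicClosure (w.adicCompletion F)) :
    (RingHom.ker ((residue ↥(closureValuationSubring (w.adicCompletion F))).comp (τR τ))).IsMaximal := by
  obtain ⟨g, rfl⟩ := exists_algEquiv_eq_structural_comp w τ
  rw [ker_residue_restrict_structural_comp_algEquiv w τR hτR g]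
  exact (g⁻¹ • w).isMaximal

variable (m : (F →+* AlgebraicClosure (w.adicCompletion F)) → ℕ)
  (hpair : ∀ τ : F →+* AlgebraicClosure (w.adicCompletion F),
    m τ + m (τ.comp ((IsCMField.complexConj F : F ≃ₐ[↥(maximalRealSubfield F)] F) : F →+* F)) = 2)
  (hbanal : ∀ τ : F →+* AlgebraicClosure (w.adicCompletion F),
    RingHom.ker ((residue ↥(closureValuationSubring (w.adicCompletion F))).comp (τR τ)) ≠ (w.asIdeal : Ideal (𝓞 F)) →
    RingHom.ker ((residue ↥(closureValuationSubring (w.adicCompletion F))).comp (τR τ)) ≠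
      (((IsCMField.complexConj F) • w).asIdeal : Ideal (𝓞 F)) →
    m τ = 0 ∨ m τ = 2)
  (hunmixed : ∀ τ τ' : F →+* AlgebraicClosure (w.adicCompletion F),
    RingHom.ker ((residue ↥(closureValuationSubring (w.adicCompletion F))).comp (τR τ)) =
      RingHom.ker ((residue ↥(closureValuationSubring (w.adicCompletion F))).comp (τR τ')) →
    RingHom.ker ((residue ↥(closureValuationSubring (w.adicCompletion F))).comp (τR τ)) ≠ w.asIdeal →
    RingHom.ker ((residue ↥(closureValuationSubring (w.adicCompletion F))).comp (τR τ)) ≠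
      ((IsCMField.complexConj F) • w).asIdeal →
    m τ = m τ')

include hτR hpair hbanal hunmixed in
/-- **Two index embeddings never induce conjugate primes**: if `m τ₁ ≠ 0`, `τ₁ ∤ c•w`, `m τ₂ ≠ 0`, `τ₂ ∤ c•w`, then `𝔭_{τ₁} ≠ 𝔭_{τ₂ ∘ c}` — on the pair
`{w, c•w}` by the exclusions, on a banal block because `m_unmixed` would give `m (τ₂ ∘ c) = m τ₁ ≠ 0`, `m_pair` then `m τ₂ = 1`, against `m_banal`.
[cite: RapoportSmithlingZhang2020Diagonal, §4.1 (4.6)–(4.8) p. 16; §3.2 (3.8) p. 11] -/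
theorem ker_ne_ker_comp_complexConj_of_mem_canType {τ₁ τ₂ : F →+* AlgebraicClosure (w.adicCompletion F)}
    (h₁ : m τ₁ ≠ 0 ∧ RingHom.ker ((residue ↥(closureValuationSubring (w.adicCompletion F))).comp (τR τ₁)) ≠
      (((IsCMField.complexConj F) • w).asIdeal : Ideal (𝓞 F)))
    (h₂ : m τ₂ ≠ 0 ∧ RingHom.ker ((residue ↥(closureValuationSubring (w.adicCompletion F))).comp (τR τ₂)) ≠
      (((IsCMField.complexConj F) • w).asIdeal : Ideal (𝓞 F))) :
    RingHom.ker ((residue ↥(closureValuationSubring (w.adicCompletion F))).comp (τR τ₁)) ≠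
      RingHom.ker ((residue ↥(closureValuationSubring (w.adicCompletion F))).comp
        (τR (τ₂.comp ((IsCMField.complexConj F : F ≃ₐ[↥(maximalRealSubfield F)] F) : F →+* F)))) := by
  intro heq
  have hconj := ker_residue_restrict_comp_complexConj w τR hτR τ₂
  -- `𝔭_{τ₂} ≠ 𝔭_w`: otherwise `𝔭_{τ₂ ∘ c} = 𝔭_{c•w} = 𝔭_{τ₁}`, excluded
  have hτ₂w : RingHom.ker ((residue ↥(closureValuationSubring (w.adicCompletion F))).comp (τR τ₂)) ≠ (w.asIdeal : Ideal (𝓞 F)) := by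
    intro h
    apply h₁.2
    rw [heq, hconj, h, HeightOneSpectrum.smul_asIdeal]
  -- `𝔭_{τ₂ ∘ c}` is banal: not `𝔭_{c•w}` (it is `𝔭_{τ₁}`), not `𝔭_w` (else `𝔭_{τ₂} = 𝔭_{c•w}`)
  have hτ₂cw : RingHom.ker ((residue ↥(closureValuationSubring (w.adicCompletion F))).comp
      (τR (τ₂.comp ((IsCMField.complexConj F : F ≃ₐ[↥(maximalRealSubfield F)] F) : F →+* F)))) ≠ (w.asIdeal : Ideal (𝓞 F)) := by
    intro h
    apply h₂.2
    have h' : (IsCMField.complexConj F) • RingHom.ker ((residue ↥(closureValuationSubring (w.adicCompletion F))).comp (τR τ₂)) =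
        (w.asIdeal : Ideal (𝓞 F)) := by rw [← hconj, h]
    rw [HeightOneSpectrum.smul_asIdeal, eq_inv_smul_iff.mpr h', complexConj_inv]
  have hτ₂cc : RingHom.ker ((residue ↥(closureValuationSubring (w.adicCompletion F))).comp
      (τR (τ₂.comp ((IsCMField.complexConj F : F ≃ₐ[↥(maximalRealSubfield F)] F) : F →+* F)))) ≠
        (((IsCMField.complexConj F) • w).asIdeal : Ideal (𝓞 F)) := by
    rw [← heq]; exact h₁.2
  -- unmixed along `𝔭_{τ₁} = 𝔭_{τ₂ ∘ c}`: `m (τ₂ ∘ c) = m τ₁ ≠ 0`; the pair law then forces `m τ₂ = 1`, against banality of `τ₂`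
  have hum := hunmixed _ _ heq.symm hτ₂cw hτ₂cc
  have hp := hpair τ₂
  have hb := hbanal τ₂ hτ₂w h₂.2
  have hm₁ := h₁.1
  have hm₂ := h₂.1
  omega

include hτR hpair hbanal hunmixed in
/-- **ROW (d) «COPRIME TO ITS CONJUGATE»: `𝔞_can(m, τR, w) ⊔ c • 𝔞_can(m, τR, w) = ⊤`** — needed by the Serre-twist cover (S1a) `𝔞_γ ⊔ 𝔞̄_γ = ⊤` at the
Frobenius datum (LA7-p02 (S6+) `h₀d`); NOT a consequence of `m_banal` alone (a mixed banal block would sit in both), it uses `m_unmixed`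
(the `PELKottLawAt` ∕ `kottRows_explicit` ∕ `kottRowsE_unmixed` token); `m_count` is not needed.  Proof: `c • ∏ 𝔭_τ = ∏ 𝔭_{τ ∘ c}`
(★ `ker_residue_restrict_comp_complexConj`), every factor is maximal (`ker_residue_restrict_isMaximal`), and no factor of the first product equals a
factor of the second (`ker_ne_ker_comp_complexConj_of_mem_canType`), so the products are coprime (Mathlib `Ideal.sup_prod_eq_top`, `IsMaximal.coprime_of_ne`).
[cite: Shimura1998, §13.1 Theorem 1 (pp. 97–99) and (7)] [cite: RapoportSmithlingZhang2020Diagonal, §4.1 (4.6)–(4.8) p. 16] -/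
theorem canonicalTwistIdeal_sup_complexConj_smul_eq_top [IsGalois ℚ F] :
    (∏ τ ∈ Finset.univ.filter (fun τ : F →+* AlgebraicClosure (w.adicCompletion F) =>
          m τ ≠ 0 ∧ RingHom.ker ((residue ↥(closureValuationSubring (w.adicCompletion F))).comp (τR τ)) ≠
            (((IsCMField.complexConj F) • w).asIdeal : Ideal (𝓞 F))),
        RingHom.ker ((residue ↥(closureValuationSubring (w.adicCompletion F))).comp (τR τ))) ⊔
      (IsCMField.complexConj F) •
        (∏ τ ∈ Finset.univ.filter (fun τ : F →+* AlgebraicClosure (w.adicCompletion F) =>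
          m τ ≠ 0 ∧ RingHom.ker ((residue ↥(closureValuationSubring (w.adicCompletion F))).comp (τR τ)) ≠
            (((IsCMField.complexConj F) • w).asIdeal : Ideal (𝓞 F))),
        RingHom.ker ((residue ↥(closureValuationSubring (w.adicCompletion F))).comp (τR τ))) = ⊤ := by
  classical
  rw [Finset.smul_prod']
  refine Ideal.sup_prod_eq_top fun τ₂ hτ₂ => ?_
  rw [sup_comm]
  refine Ideal.sup_prod_eq_top fun τ₁ hτ₁ => ?_
  rw [Finset.mem_filter] at hτ₁ hτ₂
  rw [← ker_residue_restrict_comp_complexConj w τR hτR τ₂, sup_comm]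
  exact Ideal.IsMaximal.coprime_of_ne (ker_residue_restrict_isMaximal w τR hτR τ₁) (ker_residue_restrict_isMaximal w τR hτR _)
    (ker_ne_ker_comp_complexConj_of_mem_canType w τR hτR m hpair hbanal hunmixed hτ₁.2 hτ₂.2)

end RowD

/-! ### §2 ROW (d), σ-form (`m := M ∘ (σ₁ ∘ ·)`, the HEAD-σ ∕ (S6) `h₀d` spelling) -/

section RowDSigma

variable {L : Type} [Field L] (M : (F →+* L) → ℕ)
  (σ₁ : AlgebraicClosure (w.adicCompletion F) →+* L)
  (τR₁ : (F →+* AlgebraicClosure (w.adicCompletion F)) → (𝓞 F →+* ↥(closureValuationSubring (w.adicCompletion F))))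
  (hτR₁ : ∀ (τ : F →+* AlgebraicClosure (w.adicCompletion F)) (x : 𝓞 F),
    ((τR₁ τ x : ↥(closureValuationSubring (w.adicCompletion F))) : AlgebraicClosure (w.adicCompletion F)) = τ (x : F))
  (hpair : ∀ τ : F →+* AlgebraicClosure (w.adicCompletion F),
    M (σ₁.comp τ) + M (σ₁.comp (τ.comp ((IsCMField.complexConj F : F ≃ₐ[↥(maximalRealSubfield F)] F) : F →+* F))) = 2)
  (hbanal : ∀ τ : F →+* AlgebraicClosure (w.adicCompletion F),
    RingHom.ker ((residue ↥(closureValuationSubring (w.adicCompletion F))).comp (τR₁ τ)) ≠ (w.asIdeal : Ideal (𝓞 F)) →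
    RingHom.ker ((residue ↥(closureValuationSubring (w.adicCompletion F))).comp (τR₁ τ)) ≠
      (((IsCMField.complexConj F) • w).asIdeal : Ideal (𝓞 F)) →
    M (σ₁.comp τ) = 0 ∨ M (σ₁.comp τ) = 2)
  (hunmixed : ∀ τ τ' : F →+* AlgebraicClosure (w.adicCompletion F),
    RingHom.ker ((residue ↥(closureValuationSubring (w.adicCompletion F))).comp (τR₁ τ)) =
      RingHom.ker ((residue ↥(closureValuationSubring (w.adicCompletion F))).comp (τR₁ τ')) →
    RingHom.ker ((residue ↥(closureValuationSubring (w.adicCompletion F))).comp (τR₁ τ)) ≠ w.asIdeal →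
    RingHom.ker ((residue ↥(closureValuationSubring (w.adicCompletion F))).comp (τR₁ τ)) ≠
      ((IsCMField.complexConj F) • w).asIdeal →
    M (σ₁.comp τ) = M (σ₁.comp τ'))

include hτR₁ hpair hbanal hunmixed in
/-- **ROW (d), σ-form**: `𝔞_can(M ∘ (σ₁ ∘ ·), τR₁, w) ⊔ c • 𝔞_can(M ∘ (σ₁ ∘ ·), τR₁, w) = ⊤` — the `h₀d` input of (S6) `exists_twistData_letterRows₄`
(consumer `M := mOf ι₁ (Φf i)`, the three rows from `kottRowsE` + `kottRowsE_unmixed`). [cite: Shimura1998, §13.1 Theorem 1 (pp. 97–99) and (7)]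
[cite: RapoportSmithlingZhang2020Diagonal, §4.1 (4.6)–(4.8) p. 16] -/
theorem canonicalTwistIdeal_sup_complexConj_smul_eq_top_sigma [IsGalois ℚ F] :
    (∏ τ ∈ Finset.univ.filter (fun τ : F →+* AlgebraicClosure (w.adicCompletion F) =>
          M (σ₁.comp τ) ≠ 0 ∧ RingHom.ker ((residue ↥(closureValuationSubring (w.adicCompletion F))).comp (τR₁ τ)) ≠
            (((IsCMField.complexConj F) • w).asIdeal : Ideal (𝓞 F))),
        RingHom.ker ((residue ↥(closureValuationSubring (w.adicCompletion F))).comp (τR₁ τ))) ⊔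
      (IsCMField.complexConj F) •
        (∏ τ ∈ Finset.univ.filter (fun τ : F →+* AlgebraicClosure (w.adicCompletion F) =>
          M (σ₁.comp τ) ≠ 0 ∧ RingHom.ker ((residue ↥(closureValuationSubring (w.adicCompletion F))).comp (τR₁ τ)) ≠
            (((IsCMField.complexConj F) • w).asIdeal : Ideal (𝓞 F))),
        RingHom.ker ((residue ↥(closureValuationSubring (w.adicCompletion F))).comp (τR₁ τ))) = ⊤ :=
  canonicalTwistIdeal_sup_complexConj_smul_eq_top w τR₁ hτR₁ (fun τ => M (σ₁.comp τ)) hpair hbanal hunmixed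

end RowDSigma

end Summit.HodgeConjecture.HodgeConjecture.Theorems.F0P6aCanonicalTwistIdealConjCoprime

end
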